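import Summits.AnomalousDissipation.AnomalousDissipation.Theorems.NeutralTaylorWavesTaylorWaveQuasiSteadyStubDissipationLawWTools

/-!
# Stub `stub_dissipationLawW` of the line `windfibred`
# (crux stmt-AnomalousDissipation-16293, `NeutralTaylorWaves.TaylorWaveQuasiSteady`)

**The Taylor dissipation law** (the registered signature, verbatim): for an integer frequency vector `j` with
`j i₀ ≠ 0` and a smooth `G : T³ → ℝ` not depending on `x_{i₀}`, there is `C₁ = C₁(j, G, M)` such that for every
level `n` and every smooth profile `P : T⁴ → ℝ³` whose slow gradient, phase derivative and mixed derivatives are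
bounded by `M`,
`|ν_n ‖∇(P ∘ e_n)‖₂² − ∫_{T⁴} |k|² ‖∂_θ P‖²| ≤ C₁ ε_n`,
`e_n = phaseMap j G n` the two-scale evaluation map, `ε_n = 1/(n+1)`, `ν_n = ε_n²`, `k = ∇G + j`.

Proof (all in this file and its tools file `…StubDissipationLawWTools`):
* §1 FAST-PHASE AVERAGING (`abs_integral_comp_phaseMap_sub_integral_le`): for continuous `h : T⁴ → ℝ` which is
  `D`-Lipschitz along the slow axis `i₀`, `|∫_{T³} h ∘ e_n − ∫_{T⁴} h| ≤ D ε_n`.  By TRANSLATION: `G` is invariant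
  along `e_{i₀}`, so `e_n (x + t e_{i₀}) = e_n x + t e_{i₀} + (N t) e_θ` with `N = (n+1) j_{i₀} ≠ 0`; Haar
  invariance on `T³` makes `∫ h ∘ e_n` equal to `∫_x h (e_n x + t e_{i₀} + s e_θ)` for `s = ↑(N t)`, every
  `s ∈ T¹` being reached with `|t| ≤ 1/|N| ≤ ε_n`; dropping `t e_{i₀}` costs `D ε_n`, and
  `∫_{s ∈ T¹} ∫_x h (e_n x + s e_θ) = ∫_{T⁴} h` (Haar invariance on `T¹` removes `θ_n x`, then Fubini
  `T⁴ = T³ × T¹` through `Fin.snoc`).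
* §2 POINTWISE TWO-SCALE EXPANSION: by the chain rule `∂ᵢ(P ∘ e_n) = Aᵢ + ε⁻¹kᵢ B` (`Aᵢ = ∂ᵢP ∘ e_n`,
  `B = ∂_θP ∘ e_n`), `ν_n ∑ᵢ ‖∂ᵢ(P ∘ e_n)‖² − |k|²‖B‖² = ∑ᵢ (ε²‖Aᵢ‖² + 2εkᵢ⟪Aᵢ, B⟫) = O(ε (3 + 6K₀) M²)`.
* §3 the dissipation density `h = |k ∘ slow|² ‖∂_θP‖²` is `6K₀(K₁ + K₀)M²`-Lipschitz along `e_{i₀}` (mean value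
  inequality for `kᵢ` and `∂_θP`, whose derivative along `e_{i₀}` is a mixed derivative bounded by `M`).
* §4 assembly with `C₁ = (3 + 6K₀)M² + 6K₀(K₁ + K₀)M²`, `K₀ = sup |kᵢ|`, `K₁ = sup |∂_{i₀} kᵢ|`.

Source: folklore (energy of monophase two-scale expansions; Cheverry–Guès–Métivier, Ann. Sci. ENS 36 (2003) §2;
Lifschitz–Hameiri, Phys. Fluids A 3 (1991)).
-/

-- `Summit.<Summit>.<Problem>` is the tree's mandated summit-side namespace (CONVENTIONS §2); for this
-- single-conjunct summit the two coincide, so the duplicate is deliberate.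
set_option linter.dupNamespace false

noncomputable section

open scoped BigOperators Topology InnerProductSpace
open Filter MeasureTheory Set
open Literature.Analysis.FunctionSpaces Literature.Analysis.FunctionSpaces.Torus

namespace Summit.AnomalousDissipation.AnomalousDissipation.Theorems.TaylorWaveQuasiSteady.DissipationLaw

open Summit.AnomalousDissipation.AnomalousDissipation.Theorems.TaylorWaveQuasiSteady

/-! ## §1 Fast-phase averaging by translation -/

/-- `ε_n ≤ 1`. [folklore] -/
theorem epsN_le_one (n : ℕ) : epsN n ≤ 1 := by
  unfold epsN
  rw [div_le_one (by positivity)]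
  exact le_add_of_nonneg_left (Nat.cast_nonneg n)

/-- **Fast-phase averaging.**  If `G` is continuous and invariant along the axis `i₀`, `j i₀ ≠ 0`, and
`h : T⁴ → ℝ` is continuous and `D`-Lipschitz along the slow axis `i₀`, then
`|∫_{T³} h (e_n x) dx − ∫_{T⁴} h| ≤ D ε_n`. [folklore] -/
theorem abs_integral_comp_phaseMap_sub_integral_le (j : Fin 3 → ℤ) {i₀ : Fin 3} (hj : j i₀ ≠ 0)
    {G : UnitAddTorus (Fin 3) → ℝ} (hGc : Continuous G)
    (hGinv : ∀ (x : UnitAddTorus (Fin 3)) (s : UnitAddCircle), G (x + Pi.single i₀ s) = G x) (n : ℕ)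
    {h : UnitAddTorus (Fin 4) → ℝ} (hh : Continuous h) {D : ℝ}
    (hD : ∀ (z : UnitAddTorus (Fin 4)) (t : ℝ),
      |h (z + Pi.single (Fin.castSucc i₀) (t : UnitAddCircle)) - h z| ≤ D * |t|) :
    |(∫ x, h (phaseMap j G n x)) - ∫ y, h y| ≤ D * epsN n := by
  have hθc : Continuous (fastPhase j G n) := continuous_fastPhase j n hGc
  have hec : Continuous (phaseMap j G n) := continuous_phaseMap j n hGc
  have he : ∀ x, phaseMap j G n x = @Fin.snoc 3 (fun _ => UnitAddCircle) x (fastPhase j G n x) := fun x => rfl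
  have hε0 := epsN_pos n
  have hD0 : 0 ≤ D := by
    have h1 := hD 0 1
    rw [abs_one, mul_one] at h1
    exact (abs_nonneg _).trans h1
  have hn1 : (0 : ℝ) < (n : ℝ) + 1 := by positivity
  have hj1 : (1 : ℝ) ≤ |(j i₀ : ℝ)| := by exact_mod_cast Int.one_le_abs hj
  have hjr : (j i₀ : ℝ) ≠ 0 := by exact_mod_cast hj
  -- the translation identity along `e_{i₀}`
  have htrans : ∀ (x : UnitAddTorus (Fin 3)) (t : ℝ),
      phaseMap j G n (x + Pi.single i₀ (t : UnitAddCircle)) =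
        phaseMap j G n x + Pi.single (Fin.castSucc i₀) (t : UnitAddCircle) +
          Pi.single (Fin.last 3) ((((n : ℝ) + 1) * ((j i₀ : ℝ) * t) : ℝ) : UnitAddCircle) := by
    intro x t
    rw [phaseMap_add_single, hGinv, add_sub_cancel_right]
  -- Step 1: `∫_{T⁴} h = ∫_{s ∈ T¹} ∫_x h (e_n x + s e_θ)`
  set Ψ : UnitAddTorus (Fin 4) → ℝ := fun y => h (y + Pi.single (Fin.last 3) (fastPhase j G n (slow y))) with hΨ
  have hslowc : Continuous (slow : UnitAddTorus (Fin 4) → UnitAddTorus (Fin 3)) :=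
    continuous_pi fun l => continuous_apply _
  have hΨc : Continuous Ψ :=
    hh.comp (continuous_id.add ((continuous_single _).comp (hθc.comp hslowc)))
  have hΨsnoc : ∀ (x : UnitAddTorus (Fin 3)) (s : UnitAddCircle),
      Ψ (@Fin.snoc 3 (fun _ => UnitAddCircle) x s) = h (phaseMap j G n x + Pi.single (Fin.last 3) s) := by
    intro x s
    have hsl : slow (@Fin.snoc 3 (fun _ => UnitAddCircle) x s : UnitAddTorus (Fin 4)) = x :=
      funext fun l => by simp only [slow, Fin.snoc_castSucc]
    simp only [hΨ, hsl, he, snoc_add_single_last, add_comm s]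
  have hF : ∫ y, h y = ∫ s : UnitAddCircle, ∫ x, h (phaseMap j G n x + Pi.single (Fin.last 3) s) := by
    calc ∫ y, h y = ∫ x : UnitAddTorus (Fin 3), ∫ s : UnitAddCircle, h (@Fin.snoc 3 (fun _ => UnitAddCircle) x s) :=
          integral_eq_integral_integral_snoc' hh
      _ = ∫ x : UnitAddTorus (Fin 3), ∫ s : UnitAddCircle,
            h (@Fin.snoc 3 (fun _ => UnitAddCircle) x (fastPhase j G n x + s)) := by
          congr 1
          funext x
          exact (integral_add_left_eq_self
            (fun s => h (@Fin.snoc 3 (fun _ => UnitAddCircle) x s)) (fastPhase j G n x)).symm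
      _ = ∫ x : UnitAddTorus (Fin 3), ∫ s : UnitAddCircle, Ψ (@Fin.snoc 3 (fun _ => UnitAddCircle) x s) := by
          simp only [hΨsnoc, he, snoc_add_single_last]
      _ = ∫ y, Ψ y := (integral_eq_integral_integral_snoc' hΨc).symm
      _ = ∫ s : UnitAddCircle, ∫ x : UnitAddTorus (Fin 3), Ψ (@Fin.snoc 3 (fun _ => UnitAddCircle) x s) :=
          integral_eq_integral_integral_snoc hΨc
      _ = _ := by simp only [hΨsnoc]
  -- Step 2: integrability in `s`
  have hint : Integrable (fun s : UnitAddCircle => ∫ x, h (phaseMap j G n x + Pi.single (Fin.last 3) s)) volume := by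
    refine ((integrable_snoc_prod hΨc).integral_prod_left).congr (Eventually.of_forall fun s => ?_)
    simp only [hΨsnoc]
  -- Step 3: the pointwise bound in `s`
  set A : ℝ := ∫ x, h (phaseMap j G n x) with hA
  have hpt : ∀ s : UnitAddCircle, ‖A - ∫ x, h (phaseMap j G n x + Pi.single (Fin.last 3) s)‖ ≤ D * epsN n := by
    intro s
    obtain ⟨r, hr, rfl⟩ := exists_mem_Ico_coe_eq s
    set t : ℝ := r / (((n : ℝ) + 1) * (j i₀ : ℝ)) with ht
    have hNt : ((n : ℝ) + 1) * ((j i₀ : ℝ) * t) = r := by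
      rw [ht]
      field_simp
    have htabs : |t| ≤ epsN n := by
      have hr1 : |r| ≤ 1 := by rw [abs_of_nonneg hr.1]; exact hr.2.le
      rw [ht, abs_div, abs_mul, abs_of_pos hn1]
      calc |r| / (((n : ℝ) + 1) * |(j i₀ : ℝ)|) ≤ 1 / (((n : ℝ) + 1) * |(j i₀ : ℝ)|) :=
            div_le_div_of_nonneg_right hr1 (by positivity)
        _ ≤ 1 / ((n : ℝ) + 1) :=
            one_div_le_one_div_of_le hn1 (le_mul_of_one_le_right hn1.le hj1)
        _ = epsN n := rfl
    have hi1 : Integrable (fun x => h (phaseMap j G n x + Pi.single (Fin.castSucc i₀) ((t : ℝ) : UnitAddCircle) +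
        Pi.single (Fin.last 3) ((r : ℝ) : UnitAddCircle))) volume :=
      (hh.comp ((hec.add continuous_const).add continuous_const)).integrable_unitAddTorus
    have hi2 : Integrable (fun x => h (phaseMap j G n x + Pi.single (Fin.last 3) ((r : ℝ) : UnitAddCircle))) volume :=
      (hh.comp (hec.add continuous_const)).integrable_unitAddTorus
    have hA' : A = ∫ x, h (phaseMap j G n x + Pi.single (Fin.castSucc i₀) ((t : ℝ) : UnitAddCircle) +
        Pi.single (Fin.last 3) ((r : ℝ) : UnitAddCircle)) := by
      rw [hA, ← integral_add_right_eq_self (fun x => h (phaseMap j G n x)) (Pi.single i₀ ((t : ℝ) : UnitAddCircle))]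
      congr 1
      funext x
      rw [htrans x t, hNt]
    rw [hA', ← integral_sub hi1 hi2]
    have hbound : ∀ x, ‖h (phaseMap j G n x + Pi.single (Fin.castSucc i₀) ((t : ℝ) : UnitAddCircle) +
        Pi.single (Fin.last 3) ((r : ℝ) : UnitAddCircle)) -
          h (phaseMap j G n x + Pi.single (Fin.last 3) ((r : ℝ) : UnitAddCircle))‖ ≤ D * epsN n := by
      intro x
      rw [add_right_comm, Real.norm_eq_abs]
      exact (hD _ t).trans (mul_le_mul_of_nonneg_left htabs hD0)
    have h2 := norm_integral_le_of_norm_le_const (μ := volume) (Eventually.of_forall hbound)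
    rwa [probReal_univ, mul_one] at h2
  -- Step 4: combine
  have hcomb : A - ∫ y, h y = ∫ s : UnitAddCircle, (A - ∫ x, h (phaseMap j G n x + Pi.single (Fin.last 3) s)) := by
    rw [integral_sub (integrable_const A) hint, integral_const, probReal_univ, one_smul, hF]
  rw [hcomb]
  have h3 := norm_integral_le_of_norm_le_const (μ := volume) (Eventually.of_forall hpt)
  rw [probReal_univ, mul_one, Real.norm_eq_abs] at h3
  exact h3

/-! ## §2 Pointwise two-scale expansion -/

/-- `ε²‖A + (ε⁻¹k) • B‖² − k²‖B‖² = ε²‖A‖² + 2εk⟪A, B⟫`. [folklore] -/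
theorem sq_mul_norm_add_smul_sq_sub {E : Type*} [NormedAddCommGroup E] [InnerProductSpace ℝ E]
    (A B : E) {ε : ℝ} (hε : ε ≠ 0) (k : ℝ) :
    ε ^ 2 * ‖A + (ε⁻¹ * k) • B‖ ^ 2 - k ^ 2 * ‖B‖ ^ 2 = ε ^ 2 * ‖A‖ ^ 2 + 2 * ε * k * ⟪A, B⟫_ℝ := by
  rw [norm_add_sq_real, inner_smul_right, norm_smul, mul_pow, Real.norm_eq_abs, sq_abs]
  field_simp
  ring

/-- `|ε²‖A‖² + 2εk⟪A, B⟫| ≤ ε (1 + 2K₀) M²` for `‖A‖, ‖B‖ ≤ M`, `|k| ≤ K₀`, `0 < ε ≤ 1`. [folklore] -/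
theorem abs_expansion_le {E : Type*} [NormedAddCommGroup E] [InnerProductSpace ℝ E] (A B : E)
    {ε k K₀ M : ℝ} (hε0 : 0 < ε) (hε1 : ε ≤ 1) (hM : 0 ≤ M) (hk : |k| ≤ K₀) (hA : ‖A‖ ≤ M)
    (hB : ‖B‖ ≤ M) :
    |ε ^ 2 * ‖A‖ ^ 2 + 2 * ε * k * ⟪A, B⟫_ℝ| ≤ ε * ((1 + 2 * K₀) * M ^ 2) := by
  have hK₀ : 0 ≤ K₀ := (abs_nonneg _).trans hk
  have h1 : |⟪A, B⟫_ℝ| ≤ M * M := (abs_real_inner_le_norm A B).trans (mul_le_mul hA hB (norm_nonneg _) hM)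
  have h2 : ‖A‖ ^ 2 ≤ M ^ 2 := pow_le_pow_left₀ (norm_nonneg _) hA 2
  have h3 : ε ^ 2 ≤ ε := by nlinarith
  have h4 : |2 * ε * k * ⟪A, B⟫_ℝ| = 2 * ε * |k| * |⟪A, B⟫_ℝ| := by
    rw [abs_mul, abs_mul, abs_mul, abs_of_pos hε0, abs_two]
  calc |ε ^ 2 * ‖A‖ ^ 2 + 2 * ε * k * ⟪A, B⟫_ℝ|
      ≤ |ε ^ 2 * ‖A‖ ^ 2| + |2 * ε * k * ⟪A, B⟫_ℝ| := abs_add_le _ _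
    _ = ε ^ 2 * ‖A‖ ^ 2 + 2 * ε * |k| * |⟪A, B⟫_ℝ| := by rw [abs_of_nonneg (by positivity), h4]
    _ ≤ ε * M ^ 2 + 2 * ε * K₀ * (M * M) :=
        add_le_add (mul_le_mul h3 h2 (sq_nonneg _) hε0.le)
          (mul_le_mul (mul_le_mul_of_nonneg_left hk (by positivity)) h1 (abs_nonneg _) (by positivity))
    _ = ε * ((1 + 2 * K₀) * M ^ 2) := by ring

/-! ## §3 Lipschitz bound of the dissipation density along a slow axis -/

/-- `|a'²b'² − a²b²| ≤ 2Kₐ dₐ K_b² + Kₐ² (2K_b) d_b` under the bounds `|a|, |a'| ≤ Kₐ`, `|b|, |b'| ≤ K_b`,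
`|a' − a| ≤ dₐ`, `|b' − b| ≤ d_b`. [folklore] -/
theorem abs_sq_mul_sq_sub_sq_mul_sq_le {a a' b b' Ka Kb da db : ℝ} (hKa : 0 ≤ Ka)
    (ha : |a| ≤ Ka) (ha' : |a'| ≤ Ka) (hb : |b| ≤ Kb) (hb' : |b'| ≤ Kb) (hda : |a' - a| ≤ da)
    (hdb : |b' - b| ≤ db) :
    |a' ^ 2 * b' ^ 2 - a ^ 2 * b ^ 2| ≤ 2 * Ka * da * Kb ^ 2 + Ka ^ 2 * (2 * Kb) * db := by
  have hda0 : 0 ≤ da := (abs_nonneg _).trans hda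
  have hdb0 : 0 ≤ db := (abs_nonneg _).trans hdb
  have h1 : |a' + a| ≤ 2 * Ka := (abs_add_le _ _).trans (by linarith)
  have h2 : |b' + b| ≤ 2 * Kb := (abs_add_le _ _).trans (by linarith)
  have h3 : b' ^ 2 ≤ Kb ^ 2 := sq_le_sq' (abs_le.1 hb').1 (abs_le.1 hb').2
  have h4 : a ^ 2 ≤ Ka ^ 2 := sq_le_sq' (abs_le.1 ha).1 (abs_le.1 ha).2
  have key : a' ^ 2 * b' ^ 2 - a ^ 2 * b ^ 2 = (a' - a) * (a' + a) * b' ^ 2 + a ^ 2 * ((b' - b) * (b' + b)) := by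
    ring
  rw [key]
  calc |(a' - a) * (a' + a) * b' ^ 2 + a ^ 2 * ((b' - b) * (b' + b))|
      ≤ |(a' - a) * (a' + a) * b' ^ 2| + |a ^ 2 * ((b' - b) * (b' + b))| := abs_add_le _ _
    _ = |a' - a| * |a' + a| * b' ^ 2 + a ^ 2 * (|b' - b| * |b' + b|) := by
        simp only [abs_mul, abs_pow, sq_abs]
    _ ≤ da * (2 * Ka) * Kb ^ 2 + Ka ^ 2 * (db * (2 * Kb)) :=
        add_le_add
          (mul_le_mul (mul_le_mul hda h1 (abs_nonneg _) hda0) h3 (sq_nonneg _) (mul_nonneg hda0 (by linarith)))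
          (mul_le_mul h4 (mul_le_mul hdb h2 (abs_nonneg _) hdb0) (mul_nonneg (abs_nonneg _) (abs_nonneg _))
            (sq_nonneg _))
    _ = _ := by ring

/-- **The dissipation density is Lipschitz along the slow axis `i₀`**:
`|h (z + t e_{i₀}) − h z| ≤ 6K₀(K₁ + K₀)M² |t|` for `h = dissDensity j G P`, with `K₀ ≥ sup |kᵢ|`,
`K₁ ≥ sup ‖∂_{i₀} kᵢ‖` and `M` the bound on `∂_θP` and on the mixed derivative `∂_{i₀}∂_θP`. [folklore] -/
theorem abs_dissDensity_sub_le (j : Fin 3 → ℤ) {G : UnitAddTorus (Fin 3) → ℝ} (hG : IsSmooth G)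
    {P : UnitAddTorus (Fin 4) → EuclideanSpace ℝ (Fin 3)} (hP : IsSmooth P) (i₀ : Fin 3) {K₀ K₁ M : ℝ}
    (hK₀ : 0 ≤ K₀) (hk0 : ∀ i x, |phaseGrad j G i x| ≤ K₀)
    (hk1 : ∀ i x, ‖partialDeriv i₀ (phaseGrad j G i) x‖ ≤ K₁)
    (hB : ∀ y, ‖partialDeriv (Fin.last 3) P y‖ ≤ M)
    (hB' : ∀ y, ‖partialDeriv (Fin.castSucc i₀) (partialDeriv (Fin.last 3) P) y‖ ≤ M)
    (z : UnitAddTorus (Fin 4)) (t : ℝ) :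
    |dissDensity j G P (z + Pi.single (Fin.castSucc i₀) (t : UnitAddCircle)) - dissDensity j G P z| ≤
      6 * K₀ * (K₁ + K₀) * M ^ 2 * |t| := by
  have hk1' : ∀ i, IsContDiff 1 (phaseGrad j G i) := fun i => (isSmooth_phaseGrad j hG i).isContDiff (by simp)
  have hB1 : IsContDiff 1 (partialDeriv (Fin.last 3) P) := (hP.partialDeriv _).isContDiff (by simp)
  unfold dissDensity
  rw [slow_add_single_castSucc, ← Finset.sum_sub_distrib]
  refine (Finset.abs_sum_le_sum_abs _ _).trans ?_
  have hterm : ∀ i ∈ (Finset.univ : Finset (Fin 3)),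
      |phaseGrad j G i (slow z + Pi.single i₀ (t : UnitAddCircle)) ^ 2 *
            ‖partialDeriv (Fin.last 3) P (z + Pi.single (Fin.castSucc i₀) (t : UnitAddCircle))‖ ^ 2 -
          phaseGrad j G i (slow z) ^ 2 * ‖partialDeriv (Fin.last 3) P z‖ ^ 2| ≤
        2 * K₀ * (K₁ * |t|) * M ^ 2 + K₀ ^ 2 * (2 * M) * (M * |t|) := by
    intro i _
    refine abs_sq_mul_sq_sub_sq_mul_sq_le hK₀ (hk0 i _) (hk0 i _) ?_ ?_ ?_ ?_
    · rw [abs_norm]; exact hB _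
    · rw [abs_norm]; exact hB _
    · have h1 := norm_sub_le_of_norm_partialDeriv_le (hk1' i) i₀ (hk1 i) (slow z) t
      rwa [Real.norm_eq_abs] at h1
    · exact (abs_norm_sub_norm_le _ _).trans (norm_sub_le_of_norm_partialDeriv_le hB1 _ hB' z t)
  refine (Finset.sum_le_sum hterm).trans (le_of_eq ?_)
  simp only [Finset.sum_const, Finset.card_univ, Fintype.card_fin, nsmul_eq_mul, Nat.cast_ofNat]
  ring

/-! ## §4 The registered stub -/

/-- **stub_dissipationLawW** (Taylor dissipation law; the registered signature, verbatim): for `j i₀ ≠ 0` and a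
smooth `G` with `∂_{i₀} G ≡ 0` there is `C₁` such that for all `n` and all smooth profiles `P : T⁴ → ℝ³` with
`‖∂ᵢP‖, ‖∂_θP‖, ‖∂ᵢ∂_θP‖ ≤ M`, `|ν_n‖∇(P ∘ e_n)‖₂² − ∫_{T⁴} |k|²‖∂_θP‖²| ≤ C₁ ε_n`; here
`C₁ = (3 + 6K₀)M² + 6K₀(K₁ + K₀)M²` with `K₀ = sup |kᵢ|`, `K₁ = sup ‖∂_{i₀}kᵢ‖` (§2 expansion + §1 averaging
of the `§3`-Lipschitz density). [folklore] -/
theorem stub_dissipationLawW : ∀ (j : Fin 3 → ℤ) (i₀ : Fin 3) (G : UnitAddTorus (Fin 3) → ℝ) (M : ℝ), j i₀ ≠ 0 → Literature.Analysis.FunctionSpaces.Torus.IsSmooth G → (∀ x, Literature.Analysis.FunctionSpaces.Torus.partialDeriv i₀ G x = 0) → ∃ C₁ : ℝ, ∀ (n : ℕ) (P : UnitAddTorus (Fin 4) → EuclideanSpace ℝ (Fin 3)), Literature.Analysis.FunctionSpaces.Torus.IsSmooth P → (∀ (i : Fin 3) y, ‖Literature.Analysis.FunctionSpaces.Torus.partialDeriv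 i.castSucc P y‖ ≤ M) → (∀ y, ‖Literature.Analysis.FunctionSpaces.Torus.partialDeriv (Fin.last 3) P y‖ ≤ M) → (∀ (i : Fin 3) y, ‖Literature.Analysis.FunctionSpaces.Torus.partialDeriv i.castSucc (Literature.Analysis.FunctionSpaces.Torus.partialDeriv (Fin.last 3) P) y‖ ≤ M) → |nuN n * Literature.Analysis.FunctionSpaces.Torus.gradNormSq (fun x => P (phaseMap j G n x)) - ∫ y, dissDensity j G P y| ≤ C₁ * epsN n := by
  intro j i₀ G M hj hG hG0
  have hG1 : IsContDiff 1 G := hG.isContDiff (by simp)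
  have hGc : Continuous G := hG.continuous
  have hGinv : ∀ (x : UnitAddTorus (Fin 3)) (s : UnitAddCircle), G (x + Pi.single i₀ s) = G x :=
    apply_add_single_eq_of_partialDeriv_eq_zero hG1 i₀ hG0
  -- uniform bounds of `kᵢ` and `∂_{i₀} kᵢ` (depending on `j`, `G`, `i₀` only)
  obtain ⟨K₀, hK₀, hk0⟩ := exists_forall_norm_le (fun i => phaseGrad j G i)
    fun i => (isSmooth_phaseGrad j hG i).continuous
  obtain ⟨K₁, -, hk1⟩ := exists_forall_norm_le (fun i => partialDeriv i₀ (phaseGrad j G i))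
    fun i => ((isSmooth_phaseGrad j hG i).partialDeriv i₀).continuous
  have hk0' : ∀ i x, |phaseGrad j G i x| ≤ K₀ := fun i x => by
    have h1 := hk0 i x
    rwa [Real.norm_eq_abs] at h1
  refine ⟨(3 + 6 * K₀) * M ^ 2 + 6 * K₀ * (K₁ + K₀) * M ^ 2, fun n P hP hd1 hdθ hd2 => ?_⟩
  have hM : 0 ≤ M := (norm_nonneg _).trans (hdθ 0)
  have hε0 := epsN_pos n
  have hε1 := epsN_le_one n
  have hec : Continuous (phaseMap j G n) := continuous_phaseMap j n hGc
  have hkc : ∀ i, Continuous (phaseGrad j G i) := fun i => (isSmooth_phaseGrad j hG i).continuous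
  have hAc : ∀ i : Fin 3, Continuous fun x => partialDeriv (Fin.castSucc i) P (phaseMap j G n x) :=
    fun i => (hP.partialDeriv _).continuous.comp hec
  have hBc : Continuous fun x => partialDeriv (Fin.last 3) P (phaseMap j G n x) :=
    (hP.partialDeriv _).continuous.comp hec
  -- (A) the chain rule
  have hchain : ∀ (i : Fin 3) (x : UnitAddTorus (Fin 3)),
      partialDeriv i (fun x => P (phaseMap j G n x)) x =
        partialDeriv (Fin.castSucc i) P (phaseMap j G n x) +
          ((epsN n)⁻¹ * phaseGrad j G i x) • partialDeriv (Fin.last 3) P (phaseMap j G n x) := by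
    intro i x
    rw [partialDeriv_comp_phaseMap j n hG hP i x]
    simp [epsN]
  -- (B) the pointwise expansion
  have hpt : ∀ x : UnitAddTorus (Fin 3),
      |nuN n * ∑ i, ‖partialDeriv i (fun x => P (phaseMap j G n x)) x‖ ^ 2 - dissDensity j G P (phaseMap j G n x)| ≤
        epsN n * ((3 + 6 * K₀) * M ^ 2) := by
    intro x
    simp only [hchain, dissDensity, slow_phaseMap, nuN, Finset.mul_sum, ← Finset.sum_sub_distrib,
      sq_mul_norm_add_smul_sq_sub _ _ hε0.ne']
    refine (Finset.abs_sum_le_sum_abs _ _).trans ?_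
    refine (Finset.sum_le_sum fun i _ => abs_expansion_le _ _ hε0 hε1 hM (hk0' i x) (hd1 i _) (hdθ _)).trans ?_
    simp only [Finset.sum_const, Finset.card_univ, Fintype.card_fin, nsmul_eq_mul, Nat.cast_ofNat]
    exact le_of_eq (by ring)
  -- integrability of both densities on `T³`
  have hIgrad : Integrable (fun x => ∑ i, ‖partialDeriv i (fun x => P (phaseMap j G n x)) x‖ ^ 2) volume := by
    have hc : Continuous fun x => ∑ i, ‖partialDeriv (Fin.castSucc i) P (phaseMap j G n x) +
        ((epsN n)⁻¹ * phaseGrad j G i x) • partialDeriv (Fin.last 3) P (phaseMap j G n x)‖ ^ 2 :=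
      continuous_finsetSum _ fun i _ => (((hAc i).add ((continuous_const.mul (hkc i)).smul hBc)).norm.pow 2)
    refine hc.integrable_unitAddTorus.congr (Eventually.of_forall fun x => ?_)
    simp only [hchain]
  have hdc : Continuous (dissDensity j G P) := by
    have hslow : Continuous (slow : UnitAddTorus (Fin 4) → UnitAddTorus (Fin 3)) :=
      continuous_pi fun l => continuous_apply _
    unfold dissDensity
    exact continuous_finsetSum _ fun i _ =>
      (((hkc i).comp hslow).pow 2).mul (((hP.partialDeriv _).continuous.norm).pow 2)
  have hIde : Integrable (fun x => dissDensity j G P (phaseMap j G n x)) volume := (hdc.comp hec).integrable_unitAddTorus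
  -- (B') the integrated expansion
  have hBint : |nuN n * gradNormSq (fun x => P (phaseMap j G n x)) - ∫ x, dissDensity j G P (phaseMap j G n x)| ≤
      epsN n * ((3 + 6 * K₀) * M ^ 2) := by
    unfold gradNormSq
    rw [← integral_const_mul, ← integral_sub (hIgrad.const_mul _) hIde]
    have h1 := norm_integral_le_of_norm_le_const (μ := volume)
      (Eventually.of_forall fun x => (Real.norm_eq_abs _).trans_le (hpt x))
    rwa [probReal_univ, mul_one, Real.norm_eq_abs] at h1
  -- (C) averaging of the Lipschitz density
  have hCavg : |(∫ x, dissDensity j G P (phaseMap j G n x)) - ∫ y, dissDensity j G P y| ≤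
      (6 * K₀ * (K₁ + K₀) * M ^ 2) * epsN n :=
    abs_integral_comp_phaseMap_sub_integral_le j hj hGc hGinv n hdc
      (fun z t => abs_dissDensity_sub_le j hG hP i₀ hK₀ hk0' hk1 hdθ (hd2 i₀) z t)
  calc |nuN n * gradNormSq (fun x => P (phaseMap j G n x)) - ∫ y, dissDensity j G P y|
      ≤ |nuN n * gradNormSq (fun x => P (phaseMap j G n x)) - ∫ x, dissDensity j G P (phaseMap j G n x)| +
          |(∫ x, dissDensity j G P (phaseMap j G n x)) - ∫ y, dissDensity j G P y| := abs_sub_le _ _ _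
    _ ≤ epsN n * ((3 + 6 * K₀) * M ^ 2) + (6 * K₀ * (K₁ + K₀) * M ^ 2) * epsN n := add_le_add hBint hCavg
    _ = ((3 + 6 * K₀) * M ^ 2 + 6 * K₀ * (K₁ + K₀) * M ^ 2) * epsN n := by ring

end Summit.AnomalousDissipation.AnomalousDissipation.Theorems.TaylorWaveQuasiSteady.DissipationLaw

end
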